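import Literature.AlgebraicGeometry.FundamentalGroup.RiemannExistenceContinuousRational
import Literature.AlgebraicGeometry.FundamentalGroup.RiemannExistenceNormalReduction
import Literature.RingTheory.IntegralClosure.KrullIntersection
import HarnessLib

/-!
# Riemann's existence theorem: continuous rational functions on a NORMAL variety are regular

Topic `Literature/AlgebraicGeometry/FundamentalGroup`. The tree's
`ContinuousRational.exists_eval_eq_of_continuous_rational` («a continuous rational function is
regular») and its consequence Theorem B′ (`ContinuousRational.exists_charPoly_of_algebraic`: the
characteristic polynomial of a continuous ALGEBRAIC function along a finite covering is regular)
assume all local rings REGULAR, because their all-points step runs through unique factorisation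
(Auslander–Buchsbaum). This file proves both for NORMAL varieties, which is what the reduction of
SGA 1 XII 5.1 to normal affine schemes (`riemannExistence_finiteCovering_of_normal_affine`) needs:

* `ContinuousRationalNormal.isRegularAt_of_continuous_of_normal` — all points: for `y ∈ V` the
  normal Noetherian domain `𝒪_{X,y}` is `⋂_{ht 𝔮 = 1} (𝒪_{X,y})_𝔮` (Krull, Matsumura Thm. 11.5,
  `Literature.RingTheory.IntegralClosure.exists_algebraMap_eq_of_forall_height_eq_one`), and
  `(𝒪_{X,y})_𝔮 = 𝒪_{X,y_𝔮}` is a normal local domain of dimension one, hence a DVR, hence regular,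
  where the tree's codimension-one step
  `ContinuousRational.isRegularAt_of_continuous_of_ringKrullDim_le_one` applies;
* `ContinuousRationalNormal.exists_eval_eq_of_continuous_rational_of_normal` — a continuous
  rational function on a normal variety is regular;
* `ContinuousRationalNormal.exists_charPoly_of_algebraic_of_normal` — Theorem B′ for normal
  varieties (the proof of `ContinuousRational.exists_charPoly_of_algebraic` verbatim with its two
  regularity inputs replaced);
* `riemannExistence_finiteCovering_of_algebraicSeparating` — the named fact
  `riemannExistence_finiteCovering` from the existence, on every finite covering `T → S(ℂ)` of a
  normal affine variety, of continuous functions ALGEBRAIC over `Γ(S, 𝒪_S)` separating a given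
  fibre (the residual transcendental input of SGA 1 XII 5.1, now in its weakest algebraic-function
  form: compare `riemannExistence_finiteCovering_of_integralSeparating`, which asks for INTEGRAL
  functions).

Everything here is proved; no definitions, no named facts.

## References

* [SGA1] A. Grothendieck, M. Raynaud, *SGA 1*, LNM 224 / arXiv:math/0206203, Exp. XII Thm. 5.1
  (p. 333) and its proof, part 2; Exp. XII Prop. 2.2.
* [Matsumura1987] H. Matsumura, *Commutative Ring Theory*, CSAM 8, Thm. 11.2, Thm. 11.5 (p. 82).
* [GortzWedhorn2020] U. Görtz, T. Wedhorn, *Algebraic Geometry I*, 2nd ed., Thm. 6.45 (p. 203).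

#harness_tags algebraic_geometry.sga1, algebraic_geometry.hodge_conjecture
-/

noncomputable section

open CategoryTheory AlgebraicGeometry Polynomial Ideal
open _root_.Topology

namespace Literature.AlgebraicGeometry.FundamentalGroup

open Literature.AlgebraicGeometry.Motives Literature.AlgebraicGeometry.Motives.AlgPoints
open Literature.AlgebraicGeometry.Motives.RatFn
open Literature.RingTheory.IntegralClosure

namespace ContinuousRationalNormal

/-! ### All points of a normal variety: Krull's `𝒪 = ⋂_{ht 𝔮 = 1} 𝒪_𝔮` -/

section AllPoints

variable {X : SchemeOver ℂ} [LocallyOfFiniteType X.hom] [IsIntegral X.left]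

/-- **All points, normal case.** Let `X` be integral and locally of finite type over `ℂ` with all
local rings NORMAL, `V ⊆ X` affine open, `a, b ∈ Γ(X, V)`, `a ≠ 0`, and `g` continuous on `V(ℂ)`
with `g a = b` there. Then `b / a` is regular at every `y ∈ V`: the normal Noetherian domain
`𝒪_{X,y}` is the intersection of its localisations at height-one primes `𝔮` (Matsumura 11.5,
`exists_algebraMap_eq_of_forall_height_eq_one`), `(𝒪_{X,y})_𝔮` is the local ring of the
codimension-one generization `y_𝔮 ∈ V` of `y`, which is normal of dimension one, hence regular
(a DVR), so that the codimension-one case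
`ContinuousRational.isRegularAt_of_continuous_of_ringKrullDim_le_one` applies there. (The tree's
`ContinuousRational.isRegularAt_of_continuous` is the same with «factorial» for «normal».)
[cite: Matsumura1987, Thm. 11.5 (p. 82)] [cite: GortzWedhorn2020, Thm. 6.45 (p. 203)] -/
theorem isRegularAt_of_continuous_of_normal {V : X.left.Opens} (hV : IsAffineOpen V) [Nonempty V]
    (hnorm : ∀ x : X.left, IsIntegrallyClosed (X.left.presheaf.stalk x))
    {a b : Γ(X.left, V)} (ha : a ≠ 0) {g : ComplexPoints X → ℂ}
    (hg : ContinuousOn g {P | P.pt ∈ V})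
    (hgab : ∀ (P : ComplexPoints X) (hP : P.pt ∈ V), g P * P.eval V hP a = P.eval V hP b) (y : V) :
    IsRegularAt (y : X.left)
      (algebraMap Γ(X.left, V) X.left.functionField b / algebraMap Γ(X.left, V) X.left.functionField a) := by
  classical
  set h := algebraMap Γ(X.left, V) X.left.functionField b /
    algebraMap Γ(X.left, V) X.left.functionField a
  haveI : IsLocallyNoetherian X.left := LocallyOfFiniteType.isLocallyNoetherian X.hom
  haveI := hV.isLocalization_stalk y
  haveI := hnorm y
  -- Krull: it suffices that `h ∈ (𝒪_{X,y})_𝔮` for every height-one prime `𝔮`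
  suffices hx : ∀ 𝔮 : Ideal (X.left.presheaf.stalk (y : X.left)), 𝔮.IsPrime → 𝔮.height = 1 →
      ∃ s ∉ 𝔮, ∃ r : X.left.presheaf.stalk (y : X.left),
        algebraMap _ X.left.functionField s * h = algebraMap _ X.left.functionField r by
    obtain ⟨r, hr⟩ := exists_algebraMap_eq_of_forall_height_eq_one
      (R := X.left.presheaf.stalk (y : X.left)) h hx
    exact (isRegularAt_iff_isInteger _ h).mpr ⟨r, hr⟩
  intro 𝔮 h𝔮 h𝔮1
  -- the trace `p` of `𝔮` on `Γ(X, V)` and the codimension-one point `y' = y_𝔮`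
  set p : Ideal Γ(X.left, V) := 𝔮.under Γ(X.left, V) with hp
  haveI hpp : p.IsPrime := IsPrime.under _ _
  obtain ⟨y', hpy'⟩ : ∃ y' : V, hV.primeIdealOf y' = ⟨p, hpp⟩ :=
    ⟨⟨hV.fromSpec ⟨p, hpp⟩, hV.range_fromSpec.le ⟨_, rfl⟩⟩, by
      apply hV.fromSpec.isOpenEmbedding.injective
      rw [hV.fromSpec_primeIdealOf]⟩
  haveI := hV.isLocalization_stalk y'
  have hdim : ringKrullDim (X.left.presheaf.stalk (y' : X.left)) ≤ 1 := by
    rw [IsLocalization.AtPrime.ringKrullDim_eq_height (hV.primeIdealOf y').asIdeal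
      (X.left.presheaf.stalk (y' : X.left)), hpy']
    change ((p.height : ℕ∞) : WithBot ℕ∞) ≤ 1
    rw [hp, IsLocalization.height_under (hV.primeIdealOf y).asIdeal.primeCompl 𝔮, h𝔮1]
    exact le_rfl
  -- `𝒪_{X,y'}` is normal of dimension `≤ 1`, hence regular, and `h` is regular at `y'`
  haveI := hnorm (y' : X.left)
  have hreg' : IsRegularLocalRing (X.left.presheaf.stalk (y' : X.left)) :=
    isRegularLocalRing_of_isIntegrallyClosed_of_ringKrullDim_le_one _ hdim
  have hregAt : IsRegularAt (y' : X.left) h :=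
    ContinuousRational.isRegularAt_of_continuous_of_ringKrullDim_le_one hV y' hreg' hdim ha hg hgab
  obtain ⟨a₁, b₁, hb₁, e⟩ := (isRegularAt_iff_exists hV y' h).1 hregAt
  rw [hpy'] at hb₁
  refine ⟨algebraMap Γ(X.left, V) _ b₁, fun hmem ↦ hb₁ (mem_comap.2 hmem),
    algebraMap Γ(X.left, V) _ a₁, ?_⟩
  rw [← IsScalarTower.algebraMap_apply, ← IsScalarTower.algebraMap_apply, mul_comm, e]

end AllPoints

/-! ### A continuous rational function on a normal variety is regular -/

section Main

variable {X : SchemeOver ℂ} [LocallyOfFiniteType X.hom] [IsIntegral X.left]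

/-- **A continuous rational function on a NORMAL variety is regular** (algebraic Hartogs for normal
schemes): `X` integral, locally of finite type over `ℂ`, all local rings integrally closed;
`V ⊆ X` affine open; `a, b ∈ Γ(X, V)`, `a ≠ 0`; `g` continuous on `V(ℂ)` with `g(P) a(P) = b(P)`
on `V(ℂ)`. Then `g = c` on `V(ℂ)` for some `c ∈ Γ(X, V)` (as
`ContinuousRational.exists_eval_eq_of_continuous_rational`, with `isRegularAt_of_continuous_of_normal`).
[cite: Matsumura1987, Thm. 11.5 (p. 82)] [cite: GortzWedhorn2020, Thm. 6.45 (p. 203)]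
[cite: SGA1, Exp. XII Prop. 2.2] -/
theorem exists_eval_eq_of_continuous_rational_of_normal
    (hnorm : ∀ x : X.left, IsIntegrallyClosed (X.left.presheaf.stalk x))
    {V : X.left.Opens} (hV : IsAffineOpen V) {a b : Γ(X.left, V)} (ha : a ≠ 0)
    {g : ComplexPoints X → ℂ} (hg : ContinuousOn g {P | P.pt ∈ V})
    (hgab : ∀ (P : ComplexPoints X) (hP : P.pt ∈ V), g P * P.eval V hP a = P.eval V hP b) :
    ∃ c : Γ(X.left, V), ∀ (P : ComplexPoints X) (hP : P.pt ∈ V), P.eval V hP c = g P := by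
  by_cases hVne : ((V : Set X.left)).Nonempty
  swap
  · exact ⟨0, fun P hP ↦ (hVne ⟨P.pt, hP⟩).elim⟩
  obtain ⟨y₀, hy₀⟩ := hVne
  haveI : Nonempty V := ⟨⟨y₀, hy₀⟩⟩
  have haK : algebraMap Γ(X.left, V) X.left.functionField a ≠ 0 := algebraMap_ne_zero_iff.mpr ha
  set h := algebraMap Γ(X.left, V) X.left.functionField b /
    algebraMap Γ(X.left, V) X.left.functionField a with hh
  have hξ : genericPoint X.left ∈ V :=
    ((genericPoint_spec X.left).mem_open_set_iff V.isOpen).mpr ⟨y₀, Set.mem_univ _, hy₀⟩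
  obtain ⟨c, hc⟩ := RatFn.exists_germ_eq_of_forall_isRegularAt (X := X.left) (U := V) hξ
    (h := h) fun y hy ↦ isRegularAt_of_continuous_of_normal hV hnorm ha hg hgab ⟨y, hy⟩
  have hc' : algebraMap Γ(X.left, V) X.left.functionField c = h := hc
  have hcab : c * a = b := by
    apply algebraMap_injective (V := V)
    rw [map_mul, hc', hh, div_mul_cancel₀ _ haK]
  refine ⟨c, fun P hP ↦ ?_⟩
  have key := ContinuousRational.eqOn_of_eqOn_basicOpen (X := X) ha (f := evalOrZero V c) (g := g)
    (continuousOn_evalOrZero V c) hg (fun Q hQ hQa ↦ by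
      rw [evalOrZero_of_mem c hQ]
      have h1 : Q.eval V hQ a ≠ 0 := (pt_mem_basicOpen_iff Q hQ a).mp hQa
      apply mul_right_cancel₀ h1
      rw [hgab Q hQ, ← evalRingHom_apply, ← evalRingHom_apply, ← map_mul, hcab, evalRingHom_apply])
    P hP
  have key' : evalOrZero V c P = g P := key
  rwa [evalOrZero_of_mem c hP] at key'

end Main

/-! ### Theorem B′ for normal varieties -/

section CharPoly

variable {X : SchemeOver ℂ} [IsSeparated X.hom] [LocallyOfFiniteType X.hom] [IsIntegral X.left]

open Literature.AlgebraicGeometry.Resolution in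
/-- **Theorem B′, normal case: the characteristic polynomial of a continuous algebraic function
along a finite covering of a NORMAL variety is regular.** `X` integral, separated and locally of
finite type over `ℂ` with integrally closed local rings; `U ⊆ X` affine open; `q : T → X(ℂ)` a
covering map with finite fibres; `h : T → ℂ` continuous on `q⁻¹(U(ℂ))` with `F(q t)(h t) = 0` there
for one non-zero `F ∈ Γ(X, U)[τ]`. Then there is a monic `Q ∈ Γ(X, U)[τ]` with
`roots Q(P) = {h t | t ∈ q⁻¹(P)}` for all `P ∈ U(ℂ)`. The proof is that of
`ContinuousRational.exists_charPoly_of_algebraic` verbatim (Theorem B for `a h`, `a = lead F`;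
the coefficients of `χ_h` are continuous rational functions), with its two regularity inputs
(`Γ(X, U)` integrally closed; continuous rational ⇒ regular) now supplied by normality
(`isIntegrallyClosed_sections_of_stalk`, `exists_eval_eq_of_continuous_rational_of_normal`).
[cite: SGA1, Exp. XII Thm. 5.1 (p. 333), proof, part 2] [cite: Matsumura1987, Thm. 11.5 (p. 82)] -/
theorem exists_charPoly_of_algebraic_of_normal
    (hnorm : ∀ x : X.left, IsIntegrallyClosed (X.left.presheaf.stalk x))
    {U : X.left.Opens} (hU : IsAffineOpen U) {T : Type*} [TopologicalSpace T]
    {q : T → ComplexPoints X} (hq : IsCoveringMap q) (hfin : ∀ P, (q ⁻¹' {P}).Finite)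
    (h : T → ℂ) (hh : ContinuousOn h (q ⁻¹' {P | P.pt ∈ U})) (F : Γ(X.left, U)[X]) (hF : F ≠ 0)
    (hroot : ∀ (t : T) (ht : (q t).pt ∈ U), (F.map ((q t).evalRingHom U ht)).eval (h t) = 0) :
    ∃ Q : Γ(X.left, U)[X], Q.Monic ∧ ∀ (P : ComplexPoints X) (hP : P.pt ∈ U),
      (Q.map (P.evalRingHom U hP)).roots = ((hfin P).toFinset.val).map h := by
  classical
  -- the index set `ι = U(ℂ)` and the evaluation maps
  let ι := ↥{P : ComplexPoints X | P.pt ∈ U}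
  let φ : ι → Γ(X.left, U) →+* ℂ := fun i ↦ i.1.evalRingHom U i.2
  have hφ : Function.Injective (RingHom.pi φ) := by
    refine (injective_iff_map_eq_zero _).mpr fun x hx ↦ ?_
    exact CharPolyRegular.eq_zero_of_forall_eval_eq_zero x fun P hP ↦ congrFun hx ⟨P, hP⟩
  rcases isEmpty_or_nonempty ι with hι | ⟨⟨P₀⟩⟩
  · exact ⟨1, monic_one, fun P hP ↦ (hι.false ⟨P, hP⟩).elim⟩
  haveI : Nonempty U := ⟨⟨P₀.1.pt, P₀.2⟩⟩
  have hUne : (U : Set X.left).Nonempty := ⟨P₀.1.pt, P₀.2⟩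
  have hA : IsIntegrallyClosed Γ(X.left, U) := isIntegrallyClosed_sections_of_stalk (Y := X.left) hnorm ⟨U, hU⟩
  -- fibre cardinality `d`
  haveI : PreconnectedSpace X.left := inferInstance
  set d := (hfin P₀.1).toFinset.card with hd
  have hcard : ∀ P : ComplexPoints X, (hfin P).toFinset.card = d :=
    fun P ↦ CharPolyIntegral.card_fibre_eq hq hfin P P₀.1
  let M : ComplexPoints X → Multiset ℂ := fun P ↦ ((hfin P).toFinset.val).map h
  have hMcard : ∀ P, Multiset.card (M P) = d := fun P ↦ by
    rw [Multiset.card_map, Finset.card_val, hcard]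
  by_cases hd0 : d = 0
  · refine ⟨1, monic_one, fun P hP ↦ ?_⟩
    have h1 : (hfin P).toFinset = ∅ := Finset.card_eq_zero.mp (by rw [hcard, hd0])
    rw [Polynomial.map_one, roots_one, h1]
    rfl
  -- the leading coefficient `a`, and `deg F ≥ 1`
  set a := F.leadingCoeff with hadef
  have ha : a ≠ 0 := leadingCoeff_ne_zero.mpr hF
  have hF1 : 1 ≤ F.natDegree := by
    by_contra hlt
    have h0 : F.natDegree = 0 := by omega
    have hFC : F = C a := by rw [eq_C_of_natDegree_eq_zero h0, hadef, Polynomial.leadingCoeff, h0]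
    have hne : ((X.left.basicOpen a : X.left.Opens) : Set X.left).Nonempty := by
      rw [Set.nonempty_iff_ne_empty, Ne, TopologicalSpace.Opens.coe_eq_empty]
      exact fun hbot ↦ ha ((AlgebraicGeometry.basicOpen_eq_bot_iff a).mp hbot)
    obtain ⟨P, hPa⟩ := ComplexPoints.exists_pt_mem hne (X.left.basicOpen a).isOpen.isLocallyClosed
    have hPU : P.pt ∈ U := X.left.basicOpen_le a hPa
    have hfib : (hfin P).toFinset.Nonempty := by
      rw [← Finset.card_pos, hcard]; omega
    obtain ⟨t, ht⟩ := hfib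
    have hqt : q t = P := (Set.Finite.mem_toFinset (hfin P)).mp ht
    have h2 : ∀ (P' : ComplexPoints X) (_ : q t = P') (hP' : P'.pt ∈ U),
        P'.eval U hP' a = 0 := by
      rintro _ rfl hP'
      have h3 := hroot t hP'
      rwa [hFC, map_C, eval_C, evalRingHom_apply] at h3
    exact (pt_mem_basicOpen_iff P hPU a).mp hPa (h2 P hqt hPU)
  -- `a h` is continuous and integral: Theorem B
  let h₁ : T → ℂ := fun t ↦ evalOrZero U a (q t) * h t
  have hh₁ : ContinuousOn h₁ (q ⁻¹' {P | P.pt ∈ U}) :=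
    ((continuousOn_evalOrZero U a).comp hq.continuous.continuousOn fun t ht ↦ ht).mul hh
  have hroot₁ : ∀ (t : T) (ht : (q t).pt ∈ U),
      ((integralNormalization F).map ((q t).evalRingHom U ht)).eval (h₁ t) = 0 := by
    intro t ht
    change ((integralNormalization F).map ((q t).evalRingHom U ht)).eval
      (evalOrZero U a (q t) * h t) = 0
    rw [evalOrZero_of_mem a ht, ← evalRingHom_apply, Polynomial.eval_map, hadef,
      integralNormalization_eval₂_leadingCoeff_mul hF1, ← Polynomial.eval_map, hroot t ht, mul_zero]
  obtain ⟨Q₁, hQ₁, hQ₁r⟩ := CharPolyIntegral.exists_charPoly hU hUne hA hq hfin h₁ hh₁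
    (integralNormalization F) (monic_integralNormalization hF) hroot₁
  -- `M₁(P) = a(P) M(P)` and `Q₁(P) = ∏_{z ∈ M₁(P)} (τ - z)`
  have hM₁ : ∀ (P : ComplexPoints X) (hP : P.pt ∈ U),
      ((hfin P).toFinset.val).map h₁ = (M P).map fun z ↦ P.eval U hP a * z := by
    intro P hP
    change _ = (((hfin P).toFinset.val).map h).map _
    rw [Multiset.map_map]
    refine Multiset.map_congr rfl fun t ht ↦ ?_
    have hqt : q t = P := (Set.Finite.mem_toFinset (hfin P)).mp (Finset.mem_val.mp ht)
    change evalOrZero U a (q t) * h t = P.eval U hP a * h t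
    rw [hqt, evalOrZero_of_mem a hP]
  have hQ₁P : ∀ (P : ComplexPoints X) (hP : P.pt ∈ U), Q₁.map (P.evalRingHom U hP) =
      (((M P).map fun z ↦ P.eval U hP a * z).map fun z ↦ Polynomial.X - C z).prod := by
    intro P hP
    have hm : (Q₁.map (P.evalRingHom U hP)).Monic := hQ₁.map _
    have hc : Multiset.card (Q₁.map (P.evalRingHom U hP)).roots =
        (Q₁.map (P.evalRingHom U hP)).natDegree :=
      ((IsAlgClosed.splits (Q₁.map (P.evalRingHom U hP))).natDegree_eq_card_roots).symm
    rw [← prod_multiset_X_sub_C_of_monic_of_roots_card_eq hm hc, hQ₁r P hP, hM₁ P hP]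
  -- the coefficients of `χ_h` are continuous rational functions, hence regular
  let c : ℕ → ComplexPoints X → ℂ := fun j P ↦ ((M P).map fun z ↦ Polynomial.X - C z).prod.coeff j
  have hrel : ∀ j, j ≤ d → ∀ (P : ComplexPoints X) (hP : P.pt ∈ U),
      c j P * P.eval U hP (a ^ (d - j)) = P.eval U hP (Q₁.coeff j) := by
    intro j hj P hP
    have h1 : P.eval U hP (Q₁.coeff j) = (Q₁.map (P.evalRingHom U hP)).coeff j := by
      rw [coeff_map, evalRingHom_apply]
    rw [h1, hQ₁P P hP, ContinuousRational.coeff_prod_X_sub_C_map_mul (M P) (P.eval U hP a)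
      (by rw [hMcard]; exact hj), hMcard, ← evalRingHom_apply, map_pow, evalRingHom_apply, mul_comm]
  have key : ∀ j, ∃ c' : Γ(X.left, U), ∀ (P : ComplexPoints X) (hP : P.pt ∈ U),
      P.eval U hP c' = c j P := by
    intro j
    by_cases hj : j ≤ d
    · exact exists_eval_eq_of_continuous_rational_of_normal hnorm hU (pow_ne_zero _ ha) (g := c j)
        (CharPolyIntegral.continuousOn_coeff_charPoly hq hfin h hh j) (hrel j hj)
    · refine ⟨0, fun P hP ↦ ?_⟩
      rw [← evalRingHom_apply, map_zero]
      have hdeg : ((M P).map fun z ↦ Polynomial.X - C z).prod.natDegree = d := by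
        rw [natDegree_multiset_prod_X_sub_C_eq_card, hMcard]
      exact (coeff_eq_zero_of_natDegree_lt (by rw [hdeg]; omega)).symm
  choose c' hc' using key
  obtain ⟨Q, hQm, hQ⟩ := ContinuousRational.exists_monic_map_eq_prod φ hφ (fun i ↦ M i.1) d
    (fun i ↦ hMcard i.1) c' fun j i ↦ (evalRingHom_apply i.1 U i.2 (c' j)).trans (hc' j i.1 i.2)
  refine ⟨Q, hQm, fun P hP ↦ ?_⟩
  have h1 := hQ ⟨P, hP⟩
  change Q.map (P.evalRingHom U hP) = ((M P).map fun z ↦ Polynomial.X - C z).prod at h1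
  rw [h1, roots_multiset_prod_X_sub_C]

end CharPoly

end ContinuousRationalNormal

/-! ### The named fact from algebraic separating functions on normal affine varieties -/

section Residual

/-- **`riemannExistence_finiteCovering` (SGA 1 XII 5.1, covering form) from the existence of
ALGEBRAIC separating functions on finite coverings of normal affine varieties.** For every affine
`ℂ`-scheme `S` of finite type with `Γ(S, 𝒪_S)` an integrally closed domain, every covering map
`q : T → S(ℂ)` with finite fibres and every `P₀ ∈ S(ℂ)`, assume a continuous `h : T → ℂ` injective
on `q⁻¹(P₀)` and ALGEBRAIC over `Γ(S, 𝒪_S)` (`F(q t)(h t) = 0` for one non-zero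
`F ∈ Γ(S, 𝒪_S)[τ]`, e.g. a holomorphic function on `T` algebraic over `ℂ(S)` with denominators
cleared). Then the named fact holds: the reduction to normal affine `S`
(`riemannExistence_finiteCovering_of_normal_affine`), Theorem B′ for normal varieties
(`ContinuousRationalNormal.exists_charPoly_of_algebraic_of_normal`; the local rings of `S` are
localisations of the normal domain `Γ(S, 𝒪_S)`) and Theorem A
(`CharPoly.exists_finite_etale_homeomorph_of_charPoly_of_isCoveringMap`). This is the same
transcendental input as `riemannExistence_qbarDescent_of_finiteIndex_of_algebraicSeparating`
(`RiemannExistenceQbarDescentProofs.lean`) with «smooth» replaced by «normal».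
[cite: SGA1, Exp. XII Thm. 5.1 (p. 333), proof, part 2] -/
theorem riemannExistence_finiteCovering_of_algebraicSeparating
    (H : ∀ (S : Motives.SchemeOver ℂ), IsAffine S.left → LocallyOfFiniteType S.hom →
      IsDomain Γ(S.left, ⊤) → IsIntegrallyClosed Γ(S.left, ⊤) →
      ∀ (T : Type) [TopologicalSpace T] (q : T → Motives.ComplexPoints S) (_ : IsCoveringMap q)
        (_ : ∀ t, (q ⁻¹' {t}).Finite) (P₀ : Motives.ComplexPoints S),
        ∃ (h : T → ℂ) (F : Polynomial Γ(S.left, ⊤)), Continuous h ∧ F ≠ 0 ∧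
          (∀ t, (F.map ((q t).evalRingHom ⊤ trivial)).eval (h t) = 0) ∧
          Set.InjOn h (q ⁻¹' {P₀})) :
    riemannExistence_finiteCovering := by
  refine riemannExistence_finiteCovering_of_normal_affine fun S hS hft hdom hic T _ q hq hfin ↦ ?_
  haveI := hS
  haveI := hft
  haveI := hdom
  haveI : IsSeparated S.hom := inferInstance
  refine CharPoly.exists_finite_etale_homeomorph_of_charPoly_of_isCoveringMap q hq hfin fun P₀ ↦ ?_
  haveI : Nonempty S.left := ⟨P₀.pt⟩
  haveI : IsIntegral S.left := isIntegral_of_isAffine_of_isDomain S.left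
  -- the local rings of `S` are localisations of `Γ(S, 𝒪_S)`, hence integrally closed
  haveI := hic
  have hnorm : ∀ x : S.left, IsIntegrallyClosed (S.left.presheaf.stalk x) := fun x ↦ by
    obtain ⟨y, rfl⟩ : ∃ y : (⊤ : S.left.Opens), (y : S.left) = x := ⟨⟨x, trivial⟩, rfl⟩
    haveI := (isAffineOpen_top S.left).isLocalization_stalk y
    exact isIntegrallyClosed_of_isLocalization (S.left.presheaf.stalk (y : S.left))
      ((isAffineOpen_top S.left).primeIdealOf y).asIdeal.primeCompl
      (Ideal.primeCompl_le_nonZeroDivisors _)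
  obtain ⟨h, F, hh, hF, hroot, hinj⟩ := H S hS hft hdom hic T q hq hfin P₀
  obtain ⟨Q, hQ, hroots⟩ := ContinuousRationalNormal.exists_charPoly_of_algebraic_of_normal (X := S)
    hnorm (isAffineOpen_top S.left) hq hfin h hh.continuousOn F hF (fun t _ ↦ hroot t)
  exact ⟨⊤, isAffineOpen_top S.left, trivial, h, Q, hh.continuousOn, hQ, hroots, hinj⟩

end Residual

end Literature.AlgebraicGeometry.FundamentalGroup

end
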